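import Mathlib
import Summits.KontsevichZagierPeriods.KontsevichZagierPeriods.Theses.TerasomaMultiplication

/-!
SketchIdeator1: first-lemma signatures for crux ideas shifted-family-prime-sieve and exponent-unfolding-haar; crux-ideate stmt-KontsevichZagierPeriods-12305 (MultiplicationAccessible), round 1, ideator 1.
First-lemma signatures for the idea cards; statements only (Props), nothing is proved here.
-/

noncomputable section

open Set MeasureTheory

namespace Summit.KontsevichZagierPeriods.KontsevichZagierPeriods.Cruxes.MultiplicationAccessible.Sketch

open Literature.NumberTheory.Transcendental

/-! ### Card `shifted-family-prime-sieve` -/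

/-- GM(2;x,s), the TWO-PARAMETER Legendre duplication in pure product form, with a free rational
constant `c`: `[c·ξ₀^{x-1}(1-ξ₀)^{s-1} ξ₁^{x-1/2}(1-ξ₁)^{s-1}] ~ [c·4^s ξ₀^{2x-1}(1-ξ₀)^{2s-1}(ξ₁(1-ξ₁))^{s-1}]`
on `(0,1)²` (`B(x,s)B(x+1/2,s) = 4^s B(2x,2s)B(s,s)`). Claimed provable now by ~8 moves
(Kummer `ξ = η²`, chamber split + swap, the bijection `Φ(η₀,η₁) = (η₀η₁, (1-η₀)(1+η₁)/(2(1-η₀η₁)))`). -/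
def DuplicationShifted : Prop :=
  ∀ (c x s : ℚ), 0 < c → 0 < x → 0 < s →
    ∀ (r r' : KZ.IntegralRep 2),
      r.domain = {z | ∀ i, z i ∈ Set.Ioo (0:ℝ) 1} →
      Set.EqOn r.integrand (fun z => (c:ℝ) * (z 0) ^ ((x:ℝ) - 1) * (1 - z 0) ^ ((s:ℝ) - 1) *
        (z 1) ^ ((x:ℝ) - 1/2) * (1 - z 1) ^ ((s:ℝ) - 1)) r.domain →
      r'.domain = {z | ∀ i, z i ∈ Set.Ioo (0:ℝ) 1} →
      Set.EqOn r'.integrand (fun z => (c:ℝ) * (4:ℝ) ^ (s:ℝ) * (z 0) ^ (2 * (x:ℝ) - 1) *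
        (1 - z 0) ^ (2 * (s:ℝ) - 1) * (z 1 * (1 - z 1)) ^ ((s:ℝ) - 1)) r'.domain →
      KZ.Equivalent r r'

/-- GM(m+1; x, s): the shifted Gauss-multiplication family in Beta-box form, `n = m+1`,
`∏_{k=0}^{n-1} B(x+k/n, s) = n^{ns} B(nx,ns) ∏_{j=1}^{n-1} B(js,s)`, both sides boxes of dimension `n`,
with a free rational constant `c` (coordinate `0` of the right box is the `B(nx,ns)` variable,
coordinate `j.succ` the `B((j+1)s,s)` variable). -/
def GMAt (m : ℕ) : Prop :=
  ∀ (c x s : ℚ), 0 < c → 0 < x → 0 < s →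
    ∀ (r r' : KZ.IntegralRep (m + 1)),
      r.domain = {z | ∀ i, z i ∈ Set.Ioo (0:ℝ) 1} →
      Set.EqOn r.integrand (fun z => (c:ℝ) * ∏ k : Fin (m + 1),
        (z k) ^ ((x:ℝ) + ((k:ℕ):ℝ) / ((m:ℝ) + 1) - 1) * (1 - z k) ^ ((s:ℝ) - 1)) r.domain →
      r'.domain = {z | ∀ i, z i ∈ Set.Ioo (0:ℝ) 1} →
      Set.EqOn r'.integrand (fun z => (c:ℝ) * ((m:ℝ) + 1) ^ (((m:ℝ) + 1) * (s:ℝ)) *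
        (z 0) ^ (((m:ℝ) + 1) * (x:ℝ) - 1) * (1 - z 0) ^ (((m:ℝ) + 1) * (s:ℝ) - 1) *
        ∏ j : Fin m, (z j.succ) ^ ((((j:ℕ):ℝ) + 1) * (s:ℝ) - 1) * (1 - z j.succ) ^ ((s:ℝ) - 1))
        r'.domain →
      KZ.Equivalent r r'

/-- The multiplicativity glue (cancellation-free): GM at `a` and at `b` give GM at `a*b`
(here indexed by `m = n - 1`, so `(a+1)(b+1) - 1 = a*b + a + b`). -/
def MultiplicativityGlue : Prop :=
  ∀ a b : ℕ, GMAt a → GMAt b → GMAt (a * b + a + b)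

/-- The bridge back to the crux: GM at `n = m+1`, `x = 1/n` (with `c = s`) gives the route's crux
instance at `m` (strip the value-`1` factor `s(1-t)^{s-1}` by one Newton–Leibniz move each side). -/
def CruxFromGM : Prop :=
  (∀ m, GMAt m) → Summit.KontsevichZagierPeriods.KontsevichZagierPeriods.Theses.TerasomaMultiplication.MultiplicationAccessible

/-- Sanity: `GMAt 1` is literally `DuplicationShifted` up to rewriting `∏` over `Fin 2`/`Fin 1`
(not claimed by `rfl`; a prover checks it by `Fin.prod_univ_two`/`Fin.prod_univ_one`). -/
example : Prop := GMAt 1 ↔ DuplicationShifted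

/-! ### Card `exponent-unfolding-haar` -/

/-- EXPONENT UNFOLDING is one Newton–Leibniz move: for `F` with values in `(0,1]` and `g`
semialgebraic on `σ`, `[g·F^{s-1} on σ] ~ [s·v^{s-1}·g/F on {(z,v) : z ∈ σ, 0 ≤ v ≤ F z}]`
(primitive `v^s g/F`, band `a = 0 ≤ v ≤ b = F`). Support-level, provable now. -/
def ExponentUnfolding : Prop :=
  ∀ (n : ℕ) (s : ℚ), 0 < s → ∀ (F g : (Fin n → ℝ) → ℝ) (r : KZ.IntegralRep n)
    (R : KZ.IntegralRep (n + 1)),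
    IsSemialgebraicFunOn ℚ r.domain F → IsSemialgebraicFunOn ℚ r.domain g →
    (∀ z ∈ r.domain, 0 < F z ∧ F z ≤ 1) →
    Set.EqOn r.integrand (fun z => g z * (F z) ^ ((s:ℝ) - 1)) r.domain →
    R.domain = {w | (Fin.init w : Fin n → ℝ) ∈ r.domain ∧ 0 ≤ w (Fin.last n) ∧
      w (Fin.last n) ≤ F (Fin.init w)} →
    Set.EqOn R.integrand (fun w => (s:ℝ) * (w (Fin.last n)) ^ ((s:ℝ) - 1) *
      g (Fin.init w) / F (Fin.init w)) R.domain →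
    KZ.Equivalent R r

/-- UNFOLDED MULTIPLICATION (the transfer `C⁺` of card `exponent-unfolding-haar`, crux slice
`x = 1/n`): after Kummer `x_i = η_i^n` and exponent unfolding, the crux at `m` (`n = m+1`) is the
equivalence of two `(m+1)`-dimensional representations with RATIONAL densities — the `μ_n`-twisted
dlog form `n^m ∏ η_i^i / ∏(1-η_i^n)` on the subgraph of `G = ∏(1-η_i^n)` over the box, and the
torus-Haar form `1/(∏σ_j·(n-Σσ_j))` on the subgraph of `F = ∏σ_j(n-Σσ_j)` over the simplex — the
parameter `s` sitting only in the universal last-coordinate weight `s·v^{s-1}`. -/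
def UnfoldedMultiplication : Prop :=
  ∀ (m : ℕ) (s : ℚ), 1 ≤ m → 0 < s →
    ∀ (R R' : KZ.IntegralRep (m + 1)),
      R.domain = {w | (∀ i : Fin m, w (Fin.castSucc i) ∈ Set.Ioo (0:ℝ) 1) ∧ 0 ≤ w (Fin.last m) ∧
        w (Fin.last m) ≤ ∏ i : Fin m, (1 - (w (Fin.castSucc i)) ^ (m + 1))} →
      Set.EqOn R.integrand (fun w => (s:ℝ) * (w (Fin.last m)) ^ ((s:ℝ) - 1) *
        (((m:ℝ) + 1) ^ m * ∏ i : Fin m, (w (Fin.castSucc i)) ^ (i:ℕ)) /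
        ∏ i : Fin m, (1 - (w (Fin.castSucc i)) ^ (m + 1))) R.domain →
      R'.domain = {w | (∀ i : Fin m, 0 < w (Fin.castSucc i)) ∧
        ∑ i : Fin m, w (Fin.castSucc i) < (m:ℝ) + 1 ∧ 0 ≤ w (Fin.last m) ∧
        w (Fin.last m) ≤ (∏ i : Fin m, w (Fin.castSucc i)) * ((m:ℝ) + 1 - ∑ i : Fin m, w (Fin.castSucc i))} →
      Set.EqOn R'.integrand (fun w => (s:ℝ) * (w (Fin.last m)) ^ ((s:ℝ) - 1) /
        ((∏ i : Fin m, w (Fin.castSucc i)) * ((m:ℝ) + 1 - ∑ i : Fin m, w (Fin.castSucc i)))) R'.domain →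
      KZ.Equivalent R R'

/-- The unfolded form is equivalent to the crux (Kummer + one unfolding move per side). -/
def UnfoldedIffCrux : Prop :=
  UnfoldedMultiplication ↔ Summit.KontsevichZagierPeriods.KontsevichZagierPeriods.Theses.TerasomaMultiplication.MultiplicationAccessible

end Summit.KontsevichZagierPeriods.KontsevichZagierPeriods.Cruxes.MultiplicationAccessible.Sketch
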